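import Summits.AtomisticToContinuum.Crystallization.Theorems.ExcessDecayLiouvilleCoarseGrainsPinEval
import Literature.MathematicalPhysics.StatisticalMechanics.BarlowStackingEnergy

/-!
# Envelope numerics for `PeriodicWindows` (stmt-AtomisticToContinuum-3240), line `Sketch`, stub E2b — definitions

Stub `stub_envelopeNumerics` of the line skeleton is a CERTIFIED COMPUTATION about the layer sums of the
inverse-power potentials `Vₙ(r) = r^{-2n}` (`n = 3, 6`) over a Barlow stacking with in-layer spacing `1` and
layer spacing `c`: with `t = c²`, `Q₀(i,j) = i² + ij + j²`, `Q₁ = Q₀ + i + j + 1/3` (the squared in-plane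
norms of the aligned / shifted triangular layer, i.e. `hcpSumQ (0,i,j)` / `hcpSumQ (1,i,j)` of
`…ExcessDecayLiouvilleCoarseGrainsPinSums`), every quantity of the stub is a nonnegative combination of the
PATTERN SUMS `envSum d lo bdd e t = ∑_{v = (k,i,j) admissible} (Q_d(i,j) + k² t)^{-e}`, a pattern being a
layer window (`k = lo` if `bdd`, `k ≥ lo` if not; origin excluded) with a fixed shift `d ∈ {0,1}`:
`envIn e` (in-layer, `k = 0`), `envSum 1 1 true` (layer `1`, shifted), `envSum d 2 true` (layer `2`),
`envSum d 3 false` (layers `≥ 3`).  `envU e t s` / `envL e t s` are the upper / lower site envelopes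
`2e₀ + s J(2) + 2∑_{k≥3} J(k)` / `2e₀ + s J(2)` rewritten in these sums (identification proved in
`…EnvelopeIdent`).  This file only DEFINES (D-0016: definitions are reviewed): the real objects, the two
tail constants (`envTail2`: square shells of one layer; `envTail3`: anisotropic cube shells
`[-rm,rm] × [-m,m]²`), the index boxes, the kernel-evaluable integer floor-sum evaluator `envFloorSum`
(structural recursion, `decide +kernel`, cloned from `hcpSumFloorSum`).  Proofs: `…EnvelopeTail` (tails, summability), `…EnvelopeEval` (evaluator soundness),
`…EnvelopeIdent` (identification, cell lemmas), `…EnvelopeKernel*` / `…EnvelopeGrid*` (the certificate),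
`…EnvelopeNumerics` (assembly).  Design and exact re-check: `work/numerics/env_cert.py`, `env_grid.py`
(evidence on the item).  All statements are [folklore] numerics bookkeeping.
-/

noncomputable section

namespace Summit.AtomisticToContinuum.Crystallization.Theorems.PeriodicWindowsSketch

open Finset Summit.AtomisticToContinuum.Crystallization.Theorems.ExcessDecayLiouvilleCoarseGrains

/-! ## Real side: pattern sums, envelopes, tails -/

/-- The general term `[v admissible] (Q_d(i,j) + k² t)^{-e}` of a pattern sum (`d ∈ {0,1}` the layer
shift, `t = c²`); a site `v = (k,i,j)` is ADMISSIBLE for the pattern `(lo, bdd)` iff `k = lo` (if `bdd`)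
resp. `k ≥ lo` (if `¬ bdd`) and `v ≠ 0`. [folklore] -/
def envTerm (d lo : ℕ) (bdd : Bool) (e : ℕ) (t : ℝ) (v : ℤ × ℤ × ℤ) : ℝ :=
  if (lo : ℤ) ≤ v.1 ∧ (bdd = true → v.1 ≤ lo) ∧ v ≠ 0 then
    ((hcpSumQ ((d : ℤ), v.2.1, v.2.2) + (v.1 : ℝ) ^ 2 * t)⁻¹) ^ e else 0

/-- The pattern sum `envSum d lo bdd e t = ∑_{v admissible} (Q_d + k² t)^{-e}`. [folklore] -/
def envSum (d lo : ℕ) (bdd : Bool) (e : ℕ) (t : ℝ) : ℝ := ∑' v, envTerm d lo bdd e t v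

/-- The punctured in-layer sum `∑_{(i,j) ≠ 0} Q₀(i,j)^{-e}` (pattern `k = 0`, any `t`). [folklore] -/
def envIn (e : ℕ) : ℝ := envSum 0 0 true e 0

/-- Upper site envelope `U_e(t,s) = In + 2·(layer 1, shifted) + 2·(layers ≥ 3, aligned)
+ (2 - s)·(layer 2, shifted) + s·(layer 2, aligned)`, `s = p + q ∈ {0,1,2}`. [folklore] -/
def envU (e : ℕ) (t s : ℝ) : ℝ :=
  envIn e + 2 * envSum 1 1 true e t + 2 * envSum 0 3 false e t + (2 - s) * envSum 1 2 true e t +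
    s * envSum 0 2 true e t

/-- Lower site envelope `L_e(t,s) = In + 2·(layer 1, shifted) + 2·(layers ≥ 3, shifted)
+ (2 - s)·(layer 2, shifted) + s·(layer 2, aligned)`. [folklore] -/
def envL (e : ℕ) (t s : ℝ) : ℝ :=
  envIn e + 2 * envSum 1 1 true e t + 2 * envSum 1 3 false e t + (2 - s) * envSum 1 2 true e t +
    s * envSum 0 2 true e t

/-- Tail of a ONE-LAYER pattern outside the square `[-K,K]²`:
`8 (5/3)ᵉ (K+1)^{5-2e} / (3K(K-1)(K-2))` (square shells of `8m` sites, each term `≤ ((3/5)m²)^{-e}`),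
valid for `e ≥ 3`, `K ≥ 4`, `t ≥ 0`. [folklore] -/
def envTail2 (e K : ℕ) : ℝ :=
  8 * (5 / 3 : ℝ) ^ e / ((K : ℝ) + 1) ^ (2 * e - 5) * (1 / 3) / ((K : ℝ) * (K - 1) * (K - 2))

/-- Tail of a pattern outside the anisotropic cube `[-rK,rK] × [-K,K]²`:
`25 r α^{-e} (K+1)^{6-2e} / (3K(K-1)(K-2))` (shells of `≤ r(24m²+2)` sites, each term `≤ (α m²)^{-e}`),
valid for `e ≥ 3`, `K ≥ 4`, `0 < α ≤ 3/5`, `α (K+1)² ≤ (rK+1)² t`. [folklore] -/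
def envTail3 (r : ℕ) (α : ℝ) (e K : ℕ) : ℝ :=
  25 * r * (α⁻¹) ^ e / ((K : ℝ) + 1) ^ (2 * e - 6) * (1 / 3) / ((K : ℝ) * (K - 1) * (K - 2))

/-! ## Index sets -/

/-- The evaluator box: layers `lo ≤ k < lo + nk`, `|i|, |j| ≤ K`. [folklore] -/
def envBox (lo nk K : ℕ) : Finset (ℤ × ℤ × ℤ) :=
  ((Finset.range nk).image fun kk : ℕ => ((lo + kk : ℕ) : ℤ)) ×ˢ (Icc (-(K : ℤ)) K ×ˢ Icc (-(K : ℤ)) K)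

/-- The anisotropic cube `[-rm,rm] × [-m,m]²`. [folklore] -/
def envCube (r m : ℕ) : Finset (ℤ × ℤ × ℤ) :=
  Icc (-((r * m : ℕ) : ℤ)) ((r * m : ℕ) : ℤ) ×ˢ (Icc (-(m : ℤ)) m ×ˢ Icc (-(m : ℤ)) m)

/-- The square `{l} × [-m,m]²` of layer `l`. [folklore] -/
def envSq (l : ℤ) (m : ℕ) : Finset (ℤ × ℤ × ℤ) :=
  {l} ×ˢ (Icc (-(m : ℤ)) m ×ˢ Icc (-(m : ℤ)) m)

/-! ## The integer evaluator (kernel-evaluable) -/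

/-- Integer numerator `b·(3 Q_d(i,j)) + 3 a k²` of `Q_d + k² t` at `t = a/b`:
`Q_d(i,j) + k² a/b = envNumZ / (3b)`. [folklore] -/
def envNumZ (a b d : ℕ) (k i j : ℤ) : ℤ :=
  (b : ℤ) * (3 * (i * i + i * j + j * j) + (if d = 0 then 0 else 3 * i + 3 * j + 1)) + 3 * (a : ℤ) * (k * k)

/-- Floor term `⌊M / N^e⌋` at layer `k`, indices `i = ii - K`, `j = jj - K` (`0` at the origin). [folklore] -/
def envFloorTerm (a b d k K e M ii jj : ℕ) : ℕ :=
  if k = 0 ∧ ii = K ∧ jj = K then 0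
  else M / (envNumZ a b d k ((ii : ℤ) - K) ((jj : ℤ) - K)).toNat ^ e

/-- Inner loop `∑_{jj < n}` (structural recursion). [folklore] -/
def envLoopJ (a b d k K e M ii : ℕ) : ℕ → ℕ
  | 0 => 0
  | n + 1 => envLoopJ a b d k K e M ii n + envFloorTerm a b d k K e M ii n

/-- Middle loop `∑_{ii < n} ∑_{jj ≤ 2K}`. [folklore] -/
def envLoopI (a b d k K e M : ℕ) : ℕ → ℕ
  | 0 => 0
  | n + 1 => envLoopI a b d k K e M n + envLoopJ a b d k K e M n (2 * K + 1)

/-- Outer loop over the layers `k = lo + kk`, `kk < n`. [folklore] -/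
def envLoopK (a b d lo K e M : ℕ) : ℕ → ℕ
  | 0 => 0
  | n + 1 => envLoopK a b d lo K e M n + envLoopI a b d (lo + n) K e M (2 * K + 1)

/-- The floor sum `∑_{lo ≤ k < lo+nk} ∑_{|i|,|j| ≤ K} ⌊M / N^e⌋` over the box (origin excluded): a certified
lower bound of `M · ∑ N^{-e}` and an upper bound up to the number of terms. [folklore] -/
def envFloorSum (a b d lo nk K e M : ℕ) : ℕ := envLoopK a b d lo K e M nk

/-! ## Elementary facts -/

/-- The empty layer range evaluates to `0`. [folklore] -/
theorem env_floorSum_zero (a b d lo K e M : ℕ) : envFloorSum a b d lo 0 K e M = 0 := rfl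

/-- A one-layer pattern: admissible iff `k = lo` and `v ≠ 0`. [folklore] -/
theorem envAdm_true_iff (lo : ℕ) (v : ℤ × ℤ × ℤ) :
    ((lo : ℤ) ≤ v.1 ∧ (true = true → v.1 ≤ lo) ∧ v ≠ 0) ↔ v.1 = lo ∧ v ≠ 0 := by
  constructor
  · rintro ⟨h1, h2, h3⟩; exact ⟨le_antisymm (h2 rfl) h1, h3⟩
  · rintro ⟨h1, h3⟩; exact ⟨h1.ge, fun _ => h1.le, h3⟩

/-- An unbounded pattern: admissible iff `lo ≤ k` and `v ≠ 0`. [folklore] -/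
theorem envAdm_false_iff (lo : ℕ) (v : ℤ × ℤ × ℤ) :
    ((lo : ℤ) ≤ v.1 ∧ (false = true → v.1 ≤ lo) ∧ v ≠ 0) ↔ (lo : ℤ) ≤ v.1 ∧ v ≠ 0 := by
  simp

/-- The terms are nonnegative for `t ≥ 0`. [folklore] -/
theorem envTerm_nonneg (d lo : ℕ) (bdd : Bool) (e : ℕ) {t : ℝ} (ht : 0 ≤ t) (v : ℤ × ℤ × ℤ) :
    0 ≤ envTerm d lo bdd e t v := by
  unfold envTerm
  split_ifs
  · have := hcpSumQ_nonneg ((d : ℤ), v.2.1, v.2.2)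
    positivity
  · exact le_rfl

end Summit.AtomisticToContinuum.Crystallization.Theorems.PeriodicWindowsSketch

end
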